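import Literature.NumberTheory.LFunctions.Zhang2022.MainTermFormFrequencies

/-!
# The kernel of the main-term form `𝔅` is the span of the three AFE directions

Companion to `MainTermFormPSD` and `MainTermFormFrequencies` (repair cell `pub-zhang`, autopsy of
Y. Zhang, *Discrete mean estimates and the Landau–Siegel zero*, arXiv:2211.02515 (2022)
[Zhang2022LandauSiegel]; the cell's verdict on that manuscript is NEGATIVE — the printed
inequality (8.24) fails, `Zhang2022.not_ineq824` — and this file makes no claim about its
Theorems 1–2). `MainTermFormPSD` proves that the glued main-term Hermitian form `𝔅`
(`mainTermForm`, STRUCTURE.md (4.1) of the cell) is positive semidefinite on `C¹[0,1]` and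
describes its kernel in COEFFICIENT form (`mainTermForm_eq_zero_iff`: all quarter-wave
coefficients `c_k(R₁)`, `k ≥ 2`, of the reduced modulated primitive vanish);
`MainTermFormFrequencies` evaluates `𝔅` on the pure frequencies `e^{−iπjy}`. This file closes the
remaining gap of the cell's theorem O15 (PROOF-O15 (T4), second form) in the kernel:

* `mainTermForm_eq_zero_iff_afeSpan` — for `g ∈ C¹[0,1]`,
  `𝔅(g,g) = 0 ↔ ∃ a b c, g = a e^{−iπy} + b e^{−2iπy} + c e^{−3iπy}` on `[0,1]`:
  the kernel of `𝔅` is EXACTLY the span of the three approximate-functional-equation directions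
  (STRUCTURE §5), linear combinations included (`mainTermForm_afeSpan`), and `𝔅 > 0` on every
  other `C¹` profile (`mainTermForm_pos_of_not_afeSpan`).

## Ingredients (all elementary, tagged `[folklore]`)

* Orthonormality of the quarter-wave system `e_k = √2 sin((k+½)πx)`:
  `qwCoeff_qwMode_of_ne` (from the self-adjointness identity `c_j(φ″) = −ν_j c_j(φ)` of
  `DirichletNeumannForm.qwCoeff_dd` applied to `φ = e_k`, `e_k″ = −ν_k e_k`, and `ν_j ≠ ν_k`) and
  `qwCoeff_qwMode_self` (`∫₀¹ 2sin²((k+½)πx) dx = 1`, `integral_sin_sq`).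
* Completeness, continuous version: `eqOn_zero_of_qwCoeff_eq_zero` — a function continuous on
  `[0,1]` with all coefficients zero vanishes on `[0,1]` (Parseval `hasSum_sq_qwCoeff_of_continuousOn`
  gives `∫₀¹‖f‖² = 0`; `intervalIntegral.integral_pos`). Hence `c_k(f) = 0 ∀ k ≥ 2` puts
  `f = c₀e₀ + c₁e₁` on `[0,1]` (`eqOn_modes_of_qwCoeff_eq_zero`).
* Laurent-polynomial algebra in the half-frequency variable `v = e^{−iπy/2}` (`halfPhase`):
  `e^{−iπjy} = v^{2j}`, `E = e^{3πiy/2} = v^{−3}`, `e₀ = √2(v − v⁻¹)i/2`, `e₁ = √2(v³ − v⁻³)i/2`,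
  `R* = (v⁻¹ + v)/2 − (v⁻³ + v³)/2`. With `R₁ = ES − tR*` (`rsReduce_f_apply`):
  kernel ⊆ span — `R₁ = c₀e₀ + c₁e₁` forces `S = A₀ + A₁v² + A₂v⁴ + A₃v⁶`, and `g = S′` on `(0,1)`
  (uniqueness of derivatives, `S′ = g` from `isC2_primitiveJet`), extended to `[0,1]` by
  continuity; span ⊆ kernel — `g = Σ A_j (e^{−iπjy})′` gives `S = Σ A_j(e^{−iπjy} − 1)`,
  `t = A₁ + A₂` (`rsCoeff`), and `R₁ = α e₀ + β e₁` explicitly, whose coefficients of index `≥ 2`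
  vanish by orthogonality.

NOT here: the `H¹` (kinked-profile) version of `mainTermForm_nonneg` (PROOF-O15 covers `H¹` by
density; the kernel statement above is for `C¹` profiles, the hypothesis of `MainTermFormPSD`).
-/

noncomputable section

open MeasureTheory Set intervalIntegral
open scoped Real ComplexConjugate
open Literature.Analysis.Fourier

namespace Literature.NumberTheory.LFunctions.Zhang2022

/-! ### Orthonormality of the quarter-wave sine modes -/

/-- The complexified mode `e_k = √2 sin((k+½)π·)` as a function `ℝ → ℂ`. [folklore] -/
def qwMode (k : ℕ) (x : ℝ) : ℂ := ((qwSin k x : ℝ) : ℂ)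

/-- Its derivative `e_k′`. [folklore] -/
def qwMode' (k : ℕ) (x : ℝ) : ℂ := ((√2 * (qwFreq k * Real.cos (qwFreq k * x)) : ℝ) : ℂ)

/-- Its second derivative `e_k″ = −ν_k e_k`. [folklore] -/
def qwMode'' (k : ℕ) (x : ℝ) : ℂ := ((-(qwFreq k ^ 2) * qwSin k x : ℝ) : ℂ)

/-- `e_k` is continuous. [folklore] -/
theorem continuous_qwMode (k : ℕ) : Continuous (qwMode k) := by
  unfold qwMode qwSin; fun_prop

/-- `e_k′` is continuous. [folklore] -/
theorem continuous_qwMode' (k : ℕ) : Continuous (qwMode' k) := by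
  unfold qwMode'; fun_prop

/-- `e_k″` is continuous. [folklore] -/
theorem continuous_qwMode'' (k : ℕ) : Continuous (qwMode'' k) := by
  unfold qwMode'' qwSin; fun_prop

/-- `e_k` is a `C²` jet on `[0,1]` with `e_k″ = −ν_k e_k`. [folklore] -/
theorem isC2_qwMode (k : ℕ) : IsC2OnUnitInterval (qwMode k) (qwMode' k) (qwMode'' k) :=
  ⟨(continuous_qwMode k).continuousOn, (continuous_qwMode' k).continuousOn,
    (continuous_qwMode'' k).continuousOn, fun x _ => hasDerivAt_qwSin_ofReal k x,
    fun x _ => hasDerivAt_deriv_qwSin_ofReal k x⟩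

/-- Dirichlet condition `e_k(0) = 0`. [folklore] -/
theorem qwMode_zero (k : ℕ) : qwMode k 0 = 0 := by simp [qwMode, qwSin_zero]

/-- Neumann condition `e_k′(1) = 0`. [folklore] -/
theorem qwMode'_one (k : ℕ) : qwMode' k 1 = 0 := by simp [qwMode', cos_qwFreq]

/-- `c_j(e_k″) = −ν_k c_j(e_k)` directly from `e_k″ = −ν_k e_k`. [folklore] -/
theorem qwCoeff_qwMode'' (k j : ℕ) :
    qwCoeff (qwMode'' k) j = -((qwFreq k ^ 2 : ℝ) : ℂ) * qwCoeff (qwMode k) j := by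
  rw [qwCoeff, qwCoeff, ← intervalIntegral.integral_const_mul]
  refine intervalIntegral.integral_congr fun x _ => ?_
  simp only [qwMode'', qwMode]
  push_cast
  ring

/-- The frequencies are injective in `k`: `ν_j = ν_k → j = k`. [folklore] -/
theorem qwFreq_sq_injective {j k : ℕ} (h : qwFreq j ^ 2 = qwFreq k ^ 2) : j = k := by
  have hj := (qwFreq_pos j).le
  have hk := (qwFreq_pos k).le
  have h1 : qwFreq j = qwFreq k := by
    nlinarith [sq_nonneg (qwFreq j - qwFreq k), sq_nonneg (qwFreq j + qwFreq k)]
  unfold qwFreq at h1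
  have h2 : (j : ℝ) = k := by
    have := mul_right_cancel₀ Real.pi_ne_zero h1
    linarith
  exact_mod_cast h2

/-- **Orthogonality**: `c_j(e_k) = ∫₀¹ e_k e_j = 0` for `j ≠ k` (from the self-adjointness
identity `c_j(φ″) = −ν_j c_j(φ)` applied to `φ = e_k`). [folklore] -/
theorem qwCoeff_qwMode_of_ne {j k : ℕ} (h : j ≠ k) : qwCoeff (qwMode k) j = 0 := by
  have h1 := qwCoeff_dd (isC2_qwMode k) (qwMode_zero k) (qwMode'_one k) j
  rw [qwCoeff_qwMode'' k j] at h1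
  have h2 : (((qwFreq j ^ 2 : ℝ) : ℂ) - ((qwFreq k ^ 2 : ℝ) : ℂ)) * qwCoeff (qwMode k) j = 0 := by
    linear_combination h1
  rcases mul_eq_zero.mp h2 with h3 | h3
  · exfalso
    apply h
    apply qwFreq_sq_injective
    have : ((qwFreq j ^ 2 : ℝ) : ℂ) = ((qwFreq k ^ 2 : ℝ) : ℂ) := by
      linear_combination h3
    exact_mod_cast this
  · exact h3

/-- **Normalisation**: `c_k(e_k) = ∫₀¹ e_k² = 1`. [folklore] -/
theorem qwCoeff_qwMode_self (k : ℕ) : qwCoeff (qwMode k) k = 1 := by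
  have hν := qwFreq_pos k
  have hν0 : qwFreq k ≠ 0 := hν.ne'
  have h22 : √2 * √2 = (2:ℝ) := Real.mul_self_sqrt zero_le_two
  have hreal : qwCoeff (qwMode k) k =
      ((∫ x in (0:ℝ)..1, 2 * Real.sin (qwFreq k * x) ^ 2 : ℝ) : ℂ) := by
    rw [qwCoeff, ← intervalIntegral.integral_ofReal]
    refine intervalIntegral.integral_congr fun x _ => ?_
    simp only [qwMode]
    rw [← Complex.ofReal_mul]
    congr 1
    rw [qwSin_eq]
    linear_combination Real.sin (qwFreq k * x) ^ 2 * h22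
  rw [hreal]
  have hI : ∫ x in (0:ℝ)..1, 2 * Real.sin (qwFreq k * x) ^ 2 = 1 := by
    rw [intervalIntegral.integral_const_mul,
      intervalIntegral.integral_comp_mul_left (fun x => Real.sin x ^ 2) hν0, integral_sin_sq]
    simp only [smul_eq_mul, mul_zero, mul_one, Real.sin_zero, cos_qwFreq, zero_mul, sub_zero,
      zero_add, mul_zero]
    field_simp
  rw [hI]; simp


/-! ### Linearity of the coefficients and `L²`-uniqueness for continuous profiles -/

variable {f : ℝ → ℂ}

/-- `x ↦ f(x) e_k(x)` is interval integrable on `[0,1]` for `f` continuous on `[0,1]`. [folklore] -/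
theorem intervalIntegrable_mul_qwSin (hf : ContinuousOn f (Icc 0 1)) (k : ℕ) :
    IntervalIntegrable (fun x => f x * ((qwSin k x : ℝ) : ℂ)) volume 0 1 :=
  (hf.mul (continuous_qwMode k).continuousOn).intervalIntegrable_of_Icc zero_le_one

/-- `c_k(f − a e₀ − b e₁) = c_k(f) − a c_k(e₀) − b c_k(e₁)`. [folklore] -/
theorem qwCoeff_sub_sub (hf : ContinuousOn f (Icc 0 1)) (a b : ℂ) (k : ℕ) :
    qwCoeff (fun x => f x - a * qwMode 0 x - b * qwMode 1 x) k =
      qwCoeff f k - a * qwCoeff (qwMode 0) k - b * qwCoeff (qwMode 1) k := by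
  have i0 := intervalIntegrable_mul_qwSin hf k
  have i1 := (intervalIntegrable_mul_qwSin (continuous_qwMode 0).continuousOn k).const_mul a
  have i2 := (intervalIntegrable_mul_qwSin (continuous_qwMode 1).continuousOn k).const_mul b
  rw [qwCoeff, qwCoeff, qwCoeff, qwCoeff, ← intervalIntegral.integral_const_mul,
    ← intervalIntegral.integral_const_mul, ← intervalIntegral.integral_sub i0 i1,
    ← intervalIntegral.integral_sub (i0.sub i1) i2]
  refine intervalIntegral.integral_congr fun x _ => ?_
  simp only [qwMode]
  ring

/-- `c_k(a e₀ + b e₁) = a c_k(e₀) + b c_k(e₁)`. [folklore] -/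
theorem qwCoeff_add_modes (a b : ℂ) (k : ℕ) :
    qwCoeff (fun x => a * qwMode 0 x + b * qwMode 1 x) k =
      a * qwCoeff (qwMode 0) k + b * qwCoeff (qwMode 1) k := by
  have i1 := (intervalIntegrable_mul_qwSin (continuous_qwMode 0).continuousOn k).const_mul a
  have i2 := (intervalIntegrable_mul_qwSin (continuous_qwMode 1).continuousOn k).const_mul b
  rw [qwCoeff, qwCoeff, qwCoeff, ← intervalIntegral.integral_const_mul,
    ← intervalIntegral.integral_const_mul, ← intervalIntegral.integral_add i1 i2]
  refine intervalIntegral.integral_congr fun x _ => ?_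
  simp only [qwMode]
  ring

/-- `c_k(a e₀ + b e₁) = 0` for `k ≥ 2`. [folklore] -/
theorem qwCoeff_add_modes_eq_zero (a b : ℂ) {k : ℕ} (hk : 2 ≤ k) :
    qwCoeff (fun x => a * qwMode 0 x + b * qwMode 1 x) k = 0 := by
  rw [qwCoeff_add_modes, qwCoeff_qwMode_of_ne (by omega : k ≠ 0),
    qwCoeff_qwMode_of_ne (by omega : k ≠ 1)]
  ring

/-- **`L²`-uniqueness (completeness of the quarter-wave system), continuous version**: a function
continuous on `[0,1]` all of whose quarter-wave coefficients vanish is identically zero on `[0,1]`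
(Parseval gives `∫₀¹‖f‖² = 0`, and a continuous non-negative function with zero integral
vanishes). [folklore] -/
theorem eqOn_zero_of_qwCoeff_eq_zero (hf : ContinuousOn f (Icc 0 1)) (h : ∀ k, qwCoeff f k = 0) :
    EqOn f 0 (Icc 0 1) := by
  have hP := hasSum_sq_qwCoeff_of_continuousOn hf
  simp only [h, norm_zero, ne_eq, OfNat.ofNat_ne_zero, not_false_eq_true, zero_pow] at hP
  have h0 : ∫ x in (0:ℝ)..1, ‖f x‖ ^ 2 = 0 := (hP.unique hasSum_zero)
  intro x hx
  by_contra hne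
  have hpos : 0 < ‖f x‖ ^ 2 := by
    have : f x ≠ 0 := hne
    positivity
  have hc : ContinuousOn (fun x => ‖f x‖ ^ 2) (Icc 0 1) := (hf.norm).pow 2
  have hI := intervalIntegral.integral_pos zero_lt_one hc (fun u _ => sq_nonneg _) ⟨x, hx, hpos⟩
  linarith

/-- If `c_k(f) = 0` for all `k ≥ 2` then `f = c₀(f) e₀ + c₁(f) e₁` on `[0,1]`. [folklore] -/
theorem eqOn_modes_of_qwCoeff_eq_zero (hf : ContinuousOn f (Icc 0 1))
    (h : ∀ k, 2 ≤ k → qwCoeff f k = 0) :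
    EqOn f (fun x => qwCoeff f 0 * qwMode 0 x + qwCoeff f 1 * qwMode 1 x) (Icc 0 1) := by
  set F : ℝ → ℂ := fun x => f x - qwCoeff f 0 * qwMode 0 x - qwCoeff f 1 * qwMode 1 x with hF
  have hFc : ContinuousOn F (Icc 0 1) :=
    (hf.sub (continuousOn_const.mul (continuous_qwMode 0).continuousOn)).sub
      (continuousOn_const.mul (continuous_qwMode 1).continuousOn)
  have hFk : ∀ k, qwCoeff F k = 0 := by
    intro k
    rw [hF, qwCoeff_sub_sub hf]
    rcases Nat.lt_or_ge k 2 with hk | hk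
    · interval_cases k
      · rw [qwCoeff_qwMode_self, qwCoeff_qwMode_of_ne zero_ne_one]; ring
      · rw [qwCoeff_qwMode_self, qwCoeff_qwMode_of_ne one_ne_zero]; ring
    · rw [h k hk, qwCoeff_qwMode_of_ne (by omega : k ≠ 0), qwCoeff_qwMode_of_ne (by omega : k ≠ 1)]
      ring
  intro x hx
  have := eqOn_zero_of_qwCoeff_eq_zero hFc hFk hx
  simp only [hF, Pi.zero_apply] at this
  linear_combination this

/-! ### The half-frequency variable `v = e^{−iπy/2}` -/

/-- `v(y) = e^{−iπy/2}`; every function in sight is a Laurent polynomial in `v`. [folklore] -/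
def halfPhase (y : ℝ) : ℂ := Complex.exp (-(((π / 2 * y : ℝ) : ℂ) * Complex.I))

/-- `v ≠ 0`. [folklore] -/
theorem halfPhase_ne_zero (y : ℝ) : halfPhase y ≠ 0 := Complex.exp_ne_zero _

/-- `e^{−iπjy} = v^{2j}`. [folklore] -/
theorem afeDir_eq_pow (j : ℕ) (y : ℝ) : afeDir j y = halfPhase y ^ (2 * j) := by
  rw [halfPhase, ← Complex.exp_nat_mul, afeDir, afeFreq]
  congr 1
  push_cast
  ring

/-- `E(y) = e^{3πiy/2} = v^{−3}`. [folklore] -/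
theorem modPhase_eq_pow (y : ℝ) : modPhase y = (halfPhase y)⁻¹ ^ 3 := by
  rw [halfPhase, ← Complex.exp_neg, ← Complex.exp_nat_mul, modPhase, modFreq]
  congr 1
  push_cast
  ring

/-- `conj E(y) = v³`. [folklore] -/
theorem conj_modPhase_eq_pow (y : ℝ) : conj (modPhase y) = halfPhase y ^ 3 := by
  rw [modPhase, ← Complex.exp_conj, map_mul, Complex.conj_ofReal, Complex.conj_I, halfPhase,
    ← Complex.exp_nat_mul, modFreq]
  congr 1
  push_cast
  ring

/-- `E(y)·v³ = 1`. [folklore] -/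
theorem modPhase_mul_pow (y : ℝ) : modPhase y * halfPhase y ^ 3 = 1 := by
  rw [← conj_modPhase_eq_pow, modPhase_mul_conj]

/-- `e^{iπy/2} = v⁻¹`. [folklore] -/
theorem cexp_half (y : ℝ) : Complex.exp (((π / 2 * y : ℝ) : ℂ) * Complex.I) = (halfPhase y)⁻¹ := by
  rw [halfPhase, ← Complex.exp_neg, neg_neg]

/-- `e^{3iπy/2} = v⁻³`. [folklore] -/
theorem cexp_three_half (y : ℝ) :
    Complex.exp (3 * ((π / 2 * y : ℝ) : ℂ) * Complex.I) = (halfPhase y)⁻¹ ^ 3 := by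
  rw [halfPhase, ← Complex.exp_neg, ← Complex.exp_nat_mul]
  congr 1
  push_cast
  ring

/-- `e^{−3iπy/2} = v³`. [folklore] -/
theorem cexp_neg_three_half (y : ℝ) :
    Complex.exp (-(3 * ((π / 2 * y : ℝ) : ℂ) * Complex.I)) = halfPhase y ^ 3 := by
  rw [halfPhase, ← Complex.exp_nat_mul]
  congr 1
  push_cast
  ring

/-- `e₀(y) = √2 sin(πy/2) = √2·(v − v⁻¹)·i/2`. [folklore] -/
theorem qwMode_zero_eq (y : ℝ) :
    qwMode 0 y = ((√2 : ℝ) : ℂ) * ((halfPhase y - (halfPhase y)⁻¹) * Complex.I / 2) := by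
  have h2 := Complex.two_sin (((π / 2 * y : ℝ) : ℂ))
  rw [neg_mul, cexp_half] at h2
  have hs : Complex.sin (((π / 2 * y : ℝ) : ℂ)) = (halfPhase y - (halfPhase y)⁻¹) * Complex.I / 2 := by
    rw [show Complex.exp (-(((π / 2 * y : ℝ) : ℂ) * Complex.I)) = halfPhase y from rfl] at h2
    linear_combination h2 / 2
  rw [qwMode, qwSin_eq, qwFreq_zero, Complex.ofReal_mul, Complex.ofReal_sin, ← hs]

/-- `e₁(y) = √2 sin(3πy/2) = √2·(v³ − v⁻³)·i/2`. [folklore] -/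
theorem qwMode_one_eq (y : ℝ) :
    qwMode 1 y = ((√2 : ℝ) : ℂ) * ((halfPhase y ^ 3 - (halfPhase y)⁻¹ ^ 3) * Complex.I / 2) := by
  have h2 := Complex.two_sin (3 * ((π / 2 * y : ℝ) : ℂ))
  rw [neg_mul, cexp_neg_three_half, cexp_three_half] at h2
  have hs : Complex.sin (3 * ((π / 2 * y : ℝ) : ℂ)) =
      (halfPhase y ^ 3 - (halfPhase y)⁻¹ ^ 3) * Complex.I / 2 := by
    linear_combination h2 / 2
  rw [qwMode, qwSin_eq, qwFreq_one, Complex.ofReal_mul, Complex.ofReal_sin, ← hs]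
  congr 2
  push_cast
  ring

/-- `R*(y) = cos(πy/2) − cos(3πy/2) = (v⁻¹ + v)/2 − (v⁻³ + v³)/2`. [folklore] -/
theorem rsF_eq (y : ℝ) :
    rsF y = ((halfPhase y)⁻¹ + halfPhase y) / 2 - ((halfPhase y)⁻¹ ^ 3 + halfPhase y ^ 3) / 2 := by
  have h0 := Complex.two_cos (((π / 2 * y : ℝ) : ℂ))
  rw [neg_mul, cexp_half] at h0
  have h1 := Complex.two_cos (3 * ((π / 2 * y : ℝ) : ℂ))
  rw [neg_mul, cexp_neg_three_half, cexp_three_half] at h1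
  have hc0 : Complex.cos (((π / 2 * y : ℝ) : ℂ)) = ((halfPhase y)⁻¹ + halfPhase y) / 2 := by
    rw [show Complex.exp (-(((π / 2 * y : ℝ) : ℂ) * Complex.I)) = halfPhase y from rfl] at h0
    linear_combination h0 / 2
  have hc1 : Complex.cos (3 * ((π / 2 * y : ℝ) : ℂ)) = ((halfPhase y)⁻¹ ^ 3 + halfPhase y ^ 3) / 2 := by
    linear_combination h1 / 2
  rw [rsF, qwFreq_zero, qwFreq_one, Complex.ofReal_sub, Complex.ofReal_cos, Complex.ofReal_cos,
    ← hc0, ← hc1]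
  congr 2
  all_goals (push_cast; ring)


/-! ### The kernel of `𝔅` is exactly the span of the three AFE directions -/

variable {g g' : ℝ → ℂ}

/-- `k_j′ = c_j k_j` is continuous. [folklore] -/
theorem continuous_afeDir' (j : ℕ) : Continuous (afeDir' j) := by
  unfold afeDir'; exact continuous_const.mul (continuous_afeDir j)

/-- The reduced modulated primitive `R₁` of a profile `g`, unfolded:
`R₁(y) = E(y)·S(y) − t·R*(y)` with `S(y) = ∫₀ʸ g` and `t = rsCoeff`. [folklore] -/
theorem rsReduce_f_apply (g g' : ℝ → ℂ) (y : ℝ) :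
    (rsReduce (primitiveJet g g').modulate).f y =
      modPhase y * (∫ s in (0:ℝ)..y, g s) - rsCoeff (primitiveJet g g').modulate * rsF y := rfl

/-- The reduction coefficient `t = −R′(1)/(2π) = −E(1)(g(1) + ic S(1))/(2π)`. [folklore] -/
theorem rsCoeff_modulate_primitiveJet (g g' : ℝ → ℂ) :
    rsCoeff (primitiveJet g g').modulate =
      -(modPhase 1 * (g 1 + Complex.I * modFreq * ∫ s in (0:ℝ)..1, g s)) / (2 * π) := rfl

/-- `√2 ≠ 0` in `ℂ`. [folklore] -/
theorem sqrt_two_ne_zero' : ((√2 : ℝ) : ℂ) ≠ 0 :=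
  Complex.ofReal_ne_zero.mpr (Real.sqrt_pos.mpr two_pos).ne'

/-- **Kernel ⊆ span.** If all quarter-wave coefficients `c_k(R₁)`, `k ≥ 2`, of the reduced
modulated primitive of a `C¹` profile `g` vanish, then `g` is a linear combination of
`e^{−iπy}, e^{−2iπy}, e^{−3iπy}` on `[0,1]` (PROOF-O15 (T4), second form: `L²`-completeness puts
`R₁` in `span{e₀,e₁}`, hence `S = v³(R₁ + tR*) ∈ span{1, v², v⁴, v⁶}` with `v = e^{−iπy/2}`, and
`g = S′`). [folklore] -/
theorem exists_eqOn_afeSpan_of_qwCoeff_eq_zero (hg : IsC1OnUnitInterval g g')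
    (h : ∀ k, 2 ≤ k → qwCoeff (rsReduce (primitiveJet g g').modulate).f k = 0) :
    ∃ a b c : ℂ, EqOn g (fun y => a * afeDir 1 y + b * afeDir 2 y + c * afeDir 3 y) (Icc 0 1) := by
  have hR₁ : IsC2OnUnitInterval (rsReduce (primitiveJet g g').modulate).f
      (rsReduce (primitiveJet g g').modulate).f' (rsReduce (primitiveJet g g').modulate).f'' :=
    isC2_rsReduce (Jet2.isC2_modulate (isC2_primitiveJet hg))
  set c₀ := qwCoeff (rsReduce (primitiveJet g g').modulate).f 0 with hc₀
  set c₁ := qwCoeff (rsReduce (primitiveJet g g').modulate).f 1 with hc₁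
  set t := rsCoeff (primitiveJet g g').modulate with ht
  -- Step 1: `R₁ = c₀ e₀ + c₁ e₁` on `[0,1]` (completeness).
  have h1 : EqOn (rsReduce (primitiveJet g g').modulate).f
      (fun x => c₀ * qwMode 0 x + c₁ * qwMode 1 x) (Icc 0 1) :=
    eqOn_modes_of_qwCoeff_eq_zero hR₁.cont h
  -- Step 2: `S = A₀ + A₁ v² + A₂ v⁴ + A₃ v⁶` on `[0,1]`.
  set A₀ : ℂ := -(c₁ * ((√2 : ℝ) : ℂ) * Complex.I / 2) - t / 2 with hA₀
  set A₁ : ℂ := -(c₀ * ((√2 : ℝ) : ℂ) * Complex.I / 2) + t / 2 with hA₁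
  set A₂ : ℂ := c₀ * ((√2 : ℝ) : ℂ) * Complex.I / 2 + t / 2 with hA₂
  set A₃ : ℂ := c₁ * ((√2 : ℝ) : ℂ) * Complex.I / 2 - t / 2 with hA₃
  set G : ℝ → ℂ := fun y => A₀ + A₁ * afeDir 1 y + A₂ * afeDir 2 y + A₃ * afeDir 3 y with hG
  have h2 : EqOn (fun y => ∫ s in (0:ℝ)..y, g s) G (Icc 0 1) := by
    intro y hy
    have e1 := h1 hy
    rw [rsReduce_f_apply] at e1
    have hm := modPhase_mul_pow y
    have e2 : (∫ s in (0:ℝ)..y, g s) =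
        halfPhase y ^ 3 * (c₀ * qwMode 0 y + c₁ * qwMode 1 y + t * rsF y) := by
      linear_combination (halfPhase y ^ 3) * e1 - (∫ s in (0:ℝ)..y, g s) * hm
    simp only [hG]
    rw [e2, qwMode_zero_eq, qwMode_one_eq, rsF_eq, afeDir_eq_pow, afeDir_eq_pow, afeDir_eq_pow]
    have hv := halfPhase_ne_zero y
    field_simp
    ring
  -- Step 3: `g = S′ = G′` on `(0,1)`, extended to `[0,1]` by continuity.
  have hGd : ∀ y, HasDerivAt G (A₁ * afeDir' 1 y + A₂ * afeDir' 2 y + A₃ * afeDir' 3 y) y := by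
    intro y
    exact ((((hasDerivAt_afeDir 1 y).const_mul A₁).const_add A₀).add
      ((hasDerivAt_afeDir 2 y).const_mul A₂)).add ((hasDerivAt_afeDir 3 y).const_mul A₃)
  have h3 : EqOn g (fun y => A₁ * afeDir' 1 y + A₂ * afeDir' 2 y + A₃ * afeDir' 3 y) (Icc 0 1) := by
    have hIoo : EqOn g (fun y => A₁ * afeDir' 1 y + A₂ * afeDir' 2 y + A₃ * afeDir' 3 y)
        (Ioo 0 1) := by
      intro x hx
      have hS : HasDerivAt (fun y => ∫ s in (0:ℝ)..y, g s) (g x) x :=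
        (isC2_primitiveJet hg).hasDeriv x hx
      have hSG : G =ᶠ[nhds x] (fun y => ∫ s in (0:ℝ)..y, g s) :=
        (Filter.eventuallyEq_of_mem (Icc_mem_nhds hx.1 hx.2) h2).symm
      exact (hS.congr_of_eventuallyEq hSG).unique (hGd x)
    have hc : ContinuousOn (fun y => A₁ * afeDir' 1 y + A₂ * afeDir' 2 y + A₃ * afeDir' 3 y)
        (Icc 0 1) := by
      apply Continuous.continuousOn
      exact ((continuous_const.mul (continuous_afeDir' 1)).add
        (continuous_const.mul (continuous_afeDir' 2))).add
        (continuous_const.mul (continuous_afeDir' 3))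
    refine hIoo.of_subset_closure hg.cont hc Ioo_subset_Icc_self ?_
    rw [closure_Ioo zero_ne_one]
  refine ⟨A₁ * afeFreq 1, A₂ * afeFreq 2, A₃ * afeFreq 3, fun y hy => ?_⟩
  rw [h3 hy]
  simp only [afeDir']
  ring

/-- **Span ⊆ kernel**, in primitive form: if `g = A₁k₁′ + A₂k₂′ + A₃k₃′` on `[0,1]`
(`k_j = e^{−iπjy}`), then every quarter-wave coefficient `c_k(R₁)`, `k ≥ 2`, of the reduced
modulated primitive vanishes (`S = Σ A_j(k_j − 1)`, `t = A₁ + A₂`, and `R₁ = ES − tR*` is an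
explicit combination of `e₀, e₁`). [folklore] -/
theorem qwCoeff_rsReduce_eq_zero_of_eqOn {A₁ A₂ A₃ : ℂ}
    (h : EqOn g (fun y => A₁ * afeDir' 1 y + A₂ * afeDir' 2 y + A₃ * afeDir' 3 y) (Icc 0 1))
    {k : ℕ} (hk : 2 ≤ k) : qwCoeff (rsReduce (primitiveJet g g').modulate).f k = 0 := by
  -- the primitive on `[0,1]`
  have hI : ∀ j : ℕ, j ≠ 0 → ∀ y : ℝ, ∫ s in (0:ℝ)..y, afeDir' j s = afeDir j y - 1 := by
    intro j hj y
    simp only [afeDir']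
    rw [intervalIntegral.integral_const_mul, primitive_afeDir hj]
    field_simp [afeFreq_ne_zero hj]
  have hS : ∀ y ∈ Icc (0:ℝ) 1, ∫ s in (0:ℝ)..y, g s =
      A₁ * (afeDir 1 y - 1) + A₂ * (afeDir 2 y - 1) + A₃ * (afeDir 3 y - 1) := by
    intro y hy
    have heq : EqOn g (fun y => A₁ * afeDir' 1 y + A₂ * afeDir' 2 y + A₃ * afeDir' 3 y)
        (uIcc 0 y) := by
      rw [uIcc_of_le hy.1]; exact h.mono (Icc_subset_Icc_right hy.2)
    have i : ∀ (A : ℂ) (j : ℕ), IntervalIntegrable (fun s => A * afeDir' j s) volume 0 y :=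
      fun A j => (continuous_const.mul (continuous_afeDir' j)).intervalIntegrable _ _
    rw [intervalIntegral.integral_congr heq, intervalIntegral.integral_add ((i A₁ 1).add (i A₂ 2))
      (i A₃ 3), intervalIntegral.integral_add (i A₁ 1) (i A₂ 2),
      intervalIntegral.integral_const_mul, intervalIntegral.integral_const_mul,
      intervalIntegral.integral_const_mul, hI 1 one_ne_zero, hI 2 two_ne_zero,
      hI 3 (by norm_num)]
  -- the reduction coefficient
  have ht : rsCoeff (primitiveJet g g').modulate = A₁ + A₂ := by
    have hX : g 1 + Complex.I * modFreq * (∫ s in (0:ℝ)..1, g s) =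
        -2 * π * Complex.I * (A₁ + A₂) := by
      rw [h (right_mem_Icc.2 zero_le_one), hS 1 (right_mem_Icc.2 zero_le_one)]
      simp only [afeDir', afeDir_one, afeFreq, modFreq]
      push_cast
      ring
    rw [rsCoeff_modulate_primitiveJet, hX, modPhase_one]
    have hπ : (π : ℂ) ≠ 0 := Complex.ofReal_ne_zero.mpr Real.pi_ne_zero
    field_simp
    linear_combination (-(A₁ + A₂)) * Complex.I_mul_I
  -- `R₁ ∈ span{e₀, e₁}` on `[0,1]`
  set α : ℂ := (A₂ - A₁) / (((√2 : ℝ) : ℂ) * Complex.I) with hα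
  set β : ℂ := (2 * A₃ + A₁ + A₂) / (((√2 : ℝ) : ℂ) * Complex.I) with hβ
  have hR : EqOn (rsReduce (primitiveJet g g').modulate).f
      (fun y => α * qwMode 0 y + β * qwMode 1 y) (Icc 0 1) := by
    intro y hy
    simp only
    rw [rsReduce_f_apply, ht, hS y hy, modPhase_eq_pow, rsF_eq, qwMode_zero_eq, qwMode_one_eq,
      afeDir_eq_pow, afeDir_eq_pow, afeDir_eq_pow, hα, hβ]
    have hv := halfPhase_ne_zero y
    have h2 := sqrt_two_ne_zero'
    have hInz := Complex.I_ne_zero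
    field_simp
    ring
  rw [qwCoeff_congr hR, qwCoeff_add_modes_eq_zero α β hk]

/-- A linear combination of the AFE directions, with its derivative, is a `C¹` profile. [folklore] -/
theorem isC1_afeSpan (a b c : ℂ) :
    IsC1OnUnitInterval (fun y => a * afeDir 1 y + b * afeDir 2 y + c * afeDir 3 y)
      (fun y => a * afeDir' 1 y + b * afeDir' 2 y + c * afeDir' 3 y) := by
  refine ⟨?_, ?_, fun y _ => ?_⟩
  · exact (((continuous_const.mul (continuous_afeDir 1)).add
      (continuous_const.mul (continuous_afeDir 2))).add
      (continuous_const.mul (continuous_afeDir 3))).continuousOn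
  · exact (((continuous_const.mul (continuous_afeDir' 1)).add
      (continuous_const.mul (continuous_afeDir' 2))).add
      (continuous_const.mul (continuous_afeDir' 3))).continuousOn
  · exact (((hasDerivAt_afeDir 1 y).const_mul a).add ((hasDerivAt_afeDir 2 y).const_mul b)).add
      ((hasDerivAt_afeDir 3 y).const_mul c)

/-- **O15 (T4), second form — the kernel of `𝔅` is exactly the span of the three
approximate-functional-equation directions.** For `g ∈ C¹[0,1]`:
`𝔅(g,g) = 0 ↔ g ∈ span{e^{−iπy}, e^{−2iπy}, e^{−3iπy}}` (as functions on `[0,1]`). Combines the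
coefficient form `mainTermForm_eq_zero_iff` with the completeness of the quarter-wave system
(`eqOn_zero_of_qwCoeff_eq_zero`) and the explicit Laurent-polynomial algebra in `v = e^{−iπy/2}`
relating `R₁`, `S` and `g = S′`. [folklore] -/
theorem mainTermForm_eq_zero_iff_afeSpan (hg : IsC1OnUnitInterval g g') :
    mainTermForm g g' = 0 ↔
      ∃ a b c : ℂ, EqOn g (fun y => a * afeDir 1 y + b * afeDir 2 y + c * afeDir 3 y) (Icc 0 1) := by
  rw [mainTermForm_eq_zero_iff hg]
  constructor
  · exact exists_eqOn_afeSpan_of_qwCoeff_eq_zero hg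
  · rintro ⟨a, b, c, h⟩ k hk
    have h' : EqOn g (fun y => (a / afeFreq 1) * afeDir' 1 y + (b / afeFreq 2) * afeDir' 2 y
        + (c / afeFreq 3) * afeDir' 3 y) (Icc 0 1) := by
      intro y hy
      rw [h hy]
      have h1 := afeFreq_ne_zero one_ne_zero
      have h2 := afeFreq_ne_zero two_ne_zero
      have h3 := afeFreq_ne_zero (by norm_num : (3:ℕ) ≠ 0)
      simp only [afeDir']
      field_simp
    exact qwCoeff_rsReduce_eq_zero_of_eqOn h' hk

/-- **Span ⊆ kernel** (with linear combinations, not only pure frequencies): every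
`g = a e^{−iπy} + b e^{−2iπy} + c e^{−3iπy}` has `𝔅(g,g) = 0`. [folklore] -/
theorem mainTermForm_afeSpan (a b c : ℂ) :
    mainTermForm (fun y => a * afeDir 1 y + b * afeDir 2 y + c * afeDir 3 y)
      (fun y => a * afeDir' 1 y + b * afeDir' 2 y + c * afeDir' 3 y) = 0 :=
  (mainTermForm_eq_zero_iff_afeSpan (isC1_afeSpan a b c)).mpr ⟨a, b, c, fun _ _ => rfl⟩

/-- **Strict positivity off the span**: a `C¹` profile that is not a combination of the three
AFE directions on `[0,1]` has `𝔅(g,g) > 0`. [folklore] -/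
theorem mainTermForm_pos_of_not_afeSpan (hg : IsC1OnUnitInterval g g')
    (h : ¬ ∃ a b c : ℂ, EqOn g (fun y => a * afeDir 1 y + b * afeDir 2 y + c * afeDir 3 y)
      (Icc 0 1)) : 0 < mainTermForm g g' :=
  lt_of_le_of_ne (mainTermForm_nonneg hg)
    (fun h0 => h ((mainTermForm_eq_zero_iff_afeSpan hg).mp h0.symm))

end Literature.NumberTheory.LFunctions.Zhang2022

end
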